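import Literature.AlgebraicGeometry.HodgeTheory.PencilStepBelowMiddleOfSpread
import Literature.AlgebraicGeometry.HodgeTheory.SpreadSupportsOverCurveProofs
import HarnessLib

/-!
# The pencil step below the middle dimension, granted Verdier's generic triviality and vertical rigidity

Family `hodge`, layer `Literature/AlgebraicGeometry/HodgeTheory`. Theorems only (no definitions, no
named facts, D-0026). Bookkeeping record of the closure state of the body of the named fact
`deCataldoMigliorini2009_mem_algebraicClasses_of_two_mul_le` (`PencilStepBelowMiddle`; de
Cataldo–Migliorini 2009 §4, proof of Prop. 4.5; Thomas 2005, proof of Prop. 2, case `k < d/2`):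
`PencilStepBelowMiddleOfSpread` proves it from the two leaves (I)
`spread_supports_over_projectiveLine` and (II) `vertical_rigidity_supportedClasses_projectiveLine`
(`SpreadAlgebraicClassesPencil`), and leaf (I) is now a theorem granted Verdier's generic local
triviality of pairs (`spread_supports_over_projectiveLine_of_verdier`,
`SpreadSupportsOverCurveProofs`). Hence:

* `mem_algebraicClasses_of_two_mul_le_of_verdier_of_rigidity` — the body of the fact from the
  named facts `Motives.Verdier1976_genericLocalTriviality` (Verdier 1976, Cor. (5.1)) and (II)
  alone.

## References

* [DecataldoMigliorini2009] M. A. de Cataldo, L. Migliorini, On singularities of primitive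
  cohomology classes, PAMS 137 (2009); §4 Prop. 4.5 of arXiv:0711.1307v1 (pp. 10–11).
* [Thomas2005Nodes] R. P. Thomas, Nodes and the Hodge conjecture, J. Algebraic Geom. 14 (2005),
  §2 Prop. 2 (arXiv:math/0212216 p. 4).
* [Verdier1976] J.-L. Verdier, Stratifications de Whitney et théorème de Bertini–Sard, Invent.
  Math. 36 (1976), Cor. (5.1).
* [VoisinHodgeII2003] C. Voisin, Hodge Theory and Complex Algebraic Geometry II (2003), §3.3.1,
  §10.2.1.
-/

noncomputable section

open CategoryTheory AlgebraicGeometry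

namespace Literature.AlgebraicGeometry.HodgeTheory

section HodgeTheory

open Literature.AlgebraicGeometry.Motives

/-- **The pencil step below the middle dimension, granted Verdier 1976 Cor. (5.1) and the vertical
rigidity leaf (II)**: if every rational `(q,q)`-class on every smooth projective complex `m`-fold is
algebraic (all `q`), then on a smooth projective complex `(m+1)`-fold every rational `(p,p)`-class of
degree `2p ≤ m` is algebraic — `mem_algebraicClasses_of_two_mul_le_of_spread_supports_of_rigidity`
with leaf (I) discharged by `spread_supports_over_projectiveLine_of_verdier`.
[cite: DecataldoMigliorini2009, §4 Prop. 4.5 and its proof (arXiv v1 pp. 10–11)]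
[cite: Thomas2005Nodes, §2 Prop. 2 and its proof, case k < d/2 (p. 4)]
[cite: Verdier1976, Cor. (5.1)] [cite: VoisinHodgeII2003, §3.3.1 and §10.2.1] -/
theorem mem_algebraicClasses_of_two_mul_le_of_verdier_of_rigidity
    (hGT : Verdier1976_genericLocalTriviality)
    (hII : vertical_rigidity_supportedClasses_projectiveLine)
    ⦃m : ℕ⦄ ⦃X : SchemeOver ℂ⦄ (hX : IsSmoothProjective (m + 1) X)
    (hHC : ∀ ⦃Y : SchemeOver ℂ⦄, IsSmoothProjective m Y → ∀ (q : ℕ) (c : complexBetti Y (2 * q)),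
      IsRationalClass c → IsOfHodgeType m Y (2 * q) q q c → c ∈ algebraicClasses Y q)
    (p : ℕ) (c : complexBetti X (2 * p)) (hpm : 2 * p ≤ m) (hc : IsRationalClass c)
    (hpp : IsOfHodgeType (m + 1) X (2 * p) p p c) : c ∈ algebraicClasses X p :=
  mem_algebraicClasses_of_two_mul_le_of_spread_supports_of_rigidity
    (spread_supports_over_projectiveLine_of_verdier hGT) hII hX hHC p c hpm hc hpp

end HodgeTheory

end Literature.AlgebraicGeometry.HodgeTheory

end
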